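import Literature.Computability.Complexity.ExtMonotoneCircuits
import Literature.Computability.Complexity.ExtMonotoneGRankSupport
import Literature.Computability.Complexity.MonotoneSwitching
import Literature.Computability.Complexity.CliqueTestGraphs
import Literature.Computability.Complexity.CliqueCounting
import Summits.PneNP.PneNP.Theorems.Capture.Negative.GateLocality
import Summits.PneNP.PneNP.Theorems.ConvexRankGatesCliqueExtLowerBoundStubNarrowAlgebraicHelpers
import Summits.PneNP.PneNP.Theorems.ConvexRankGatesCliqueExtLowerBoundStubNarrowAlgebraic
import Mathlib

/-!
# Effective width: wide gates with SHORT accepted patterns are sandwichable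
(helpers for the stubs `stub_algebraicSandwichable` / `stub_convSandwichable` of the line
`width-threshold-certificate-sparsity`, crux `ConvexRankGates.CliqueExtLowerBound`, stmt-PneNP-10682)

The landed width threshold (`stub_narrowAlgebraic`) sandwiches a gate whose EVERY accepted input has
an accepted sub-pattern of `≤ L = T (log₂ T + 1)` on-wires, `T = ⌊m^{1/16}⌋₊`. The same engine
(switch a short DNF up once and down once, Jukna 2012 Lemma 9.15; mass lemmas and numerics of
`…StubNarrowAlgebraicHelpers`) proves more; recorded here in the unfolded vocabulary of the stubs
(positives = clique vectors of the `⌈m^{1/4}⌉₊`-sets, negatives = complements of the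
`#E/⌊m^{1/8}⌋₊`-subsets of the edge slots, error `1/(8 m^{c+1})`):

* `sandwichable_of_shortDNF` (REGISTERED, the engine): ANY gate `φ` with ANY children `(D, C)` is
  sandwichable at `(r, s)` as soon as some DNF `A₀` over the edges with monomials of `≤ L (r - 1)`
  edges lies below `x ↦ φ(C(x))` on the negatives and covers all but a `1/(16 m^{c+1})` fraction of
  the positives accepted by `x ↦ φ(D(x))` (`r ≥ C(4(c+4), 2) + 1`, `s ≥ 16 (c+3)`, `m` large).
* `sandwichable_of_shortPatterns` (wire level): a MONOTONE gate fed with consistent local children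
  is sandwichable as soon as all but a `1/(16 m^{c+1})` fraction of the accepted positive
  push-forwards `D(x)` dominate an accepted indicator of `≤ L` on-wires ("effectively narrow on the
  positives"; `A₀ :=` the big DNF of the `L`-truncation of `φ`, `exists_bigDNF`).
* `grank_smallThreshold_sandwichable`, `perm_smallGroup_sandwichable`: in particular every GRANK
  gate of ANY dimension with rank threshold `θ ≤ L` (a non-vanishing `θ`-minor has a monomial with
  `≤ θ` variables, `grank_local`) and every PERM gate on ANY number of points whose generators
  generate a group of order `< 2^{L+1}` (independent generating sets double the order,
  `two_pow_card_le_card_closure`) is sandwichable — wide cases of `stub_algebraicSandwichable`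
  settled outright.

So the open residue of the two stubs is: wide gates accepting `≥ #P/(16 m^{c+1})` bare cliques ONLY
through accepted wire patterns with more than `L` wires simultaneously on (GRANK: `θ > L`; PERM:
accepting products needing `> L` generators of a group of order `≥ 2^{L+1}`), while still rejecting
`> #N/(8 m^{c+1})` dense negatives with acceptance not pierced by `s - 1` edges (`…SandwichHelpers`).

References: S. Jukna, *Boolean Function Complexity* (2012), Lemma 9.15, Thm. 9.17 [Jukna2012].
-/
set_option linter.dupNamespace false

open Literature.Computability.Complexity Filter Finset

namespace Summit.PneNP.PneNP.Theorems.CliqueExtLowerBound.WidthThreshold.SandwichEffectiveWidth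

open Summit.PneNP.PneNP.Theorems.CliqueExtLowerBound.WidthThreshold.NarrowAlgebraicHelpers
open Summit.PneNP.PneNP.Theorems.CliqueExtLowerBound.WidthThreshold.NarrowAlgebraic
  (card_mul_le_of_subset_biUnion exists_bigDNF)

open Classical in
/-- REGISTERED SUB-GOAL (binder-free). **A short DNF between the two push-forwards sandwiches the
gate.** For every `c` there are `r₀ = C(4(c+4),2) + 1`, `s₀ = 16(c+3)` such that for `r ≥ r₀`,
`s ≥ s₀` and all large `m`: for ANY gate `φ`, ANY children `D, C` and any DNF `A₀` over the edge
slots with monomials of at most `⌊m^{1/16}⌋₊ (log₂ ⌊m^{1/16}⌋₊ + 1) (r-1)` edges such that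
(i) `A₀(x) = 1 ⇒ φ(C(x)) = 1` for every negative `x` and (ii) at most `#P / (16 m^{c+1})` positives
have `φ(D(x)) = 1 ∧ A₀(x) = 0`, the conclusion of the stubs holds for `(φ, D, C)`: switch `A₀` up to
an `(s-1)`-CNF `B` (exceptional exact `s`-clauses `Cf`, `≤ ℓ^s` of them, each failing on `≤ D^{-s} #N`
negatives) and `B` down to an `(r-1)`-DNF `A` (exceptional exact `r`-monomials `Df`, `≤ (s-1)^r`,
each holding on `≤ Q^{-4(c+4)} #P` positives, `Q = m/k`); output `(A, B)`.
[cite: Jukna2012, Lemma 9.15] -/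
theorem sandwichable_of_shortDNF : ∀ c : ℕ, ∃ r₀ s₀ : ℕ, 2 ≤ r₀ ∧ 2 ≤ s₀ ∧ ∀ r s : ℕ, r₀ ≤ r → s₀ ≤ s →
    ∀ᶠ m : ℕ in atTop, ∀ (φ : GateFn)
      (D C : Fin φ.1 → Finset (Finset ((⊤ : SimpleGraph (Fin m)).edgeSet)))
      (A₀ : Finset (Finset ((⊤ : SimpleGraph (Fin m)).edgeSet))),
      (∀ R ∈ A₀, #R ≤ ⌊(m : ℝ) ^ (1 / 16 : ℝ)⌋₊ * (Nat.log 2 ⌊(m : ℝ) ^ (1 / 16 : ℝ)⌋₊ + 1) * (r - 1)) →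
      (∀ x ∈ ((powersetCard (Fintype.card ((⊤ : SimpleGraph (Fin m)).edgeSet) / ⌊(m : ℝ) ^ (1 / 8 : ℝ)⌋₊)
          (univ : Finset ((⊤ : SimpleGraph (Fin m)).edgeSet))).image (fun M => fun e => decide (e ∉ M))),
        EvalDNF A₀ x → φ.2 (fun j => decide (EvalCNF (C j) x)) = true) →
      #((posGraphs m ⌈(m : ℝ) ^ (1 / 4 : ℝ)⌉₊).filter
          (fun x => φ.2 (fun j => decide (EvalDNF (D j) x)) = true ∧ ¬ EvalDNF A₀ x)) * (16 * m ^ (c + 1))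
        ≤ #(posGraphs m ⌈(m : ℝ) ^ (1 / 4 : ℝ)⌉₊) →
      ∃ dnf cnf : Finset (Finset ((⊤ : SimpleGraph (Fin m)).edgeSet)),
        (∀ R ∈ dnf, #R ≤ r - 1) ∧ (∀ S ∈ cnf, #S ≤ s - 1) ∧
        (∀ x, EvalDNF dnf x → EvalCNF cnf x) ∧
        (#((posGraphs m ⌈(m : ℝ) ^ (1 / 4 : ℝ)⌉₊).filter
            (fun x => φ.2 (fun j => decide (EvalDNF (D j) x)) = true ∧ ¬ EvalDNF dnf x)) : ℝ)
          ≤ (1 / (8 * (m : ℝ) ^ (c + 1))) * #(posGraphs m ⌈(m : ℝ) ^ (1 / 4 : ℝ)⌉₊) ∧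
        (#((((powersetCard (Fintype.card ((⊤ : SimpleGraph (Fin m)).edgeSet) / ⌊(m : ℝ) ^ (1 / 8 : ℝ)⌋₊)
        (univ : Finset ((⊤ : SimpleGraph (Fin m)).edgeSet))).image (fun M => fun e => decide (e ∉ M)))).filter
            (fun x => EvalCNF cnf x ∧ φ.2 (fun j => decide (EvalCNF (C j) x)) = false)) : ℝ)
          ≤ (1 / (8 * (m : ℝ) ^ (c + 1))) *
            #(((powersetCard (Fintype.card ((⊤ : SimpleGraph (Fin m)).edgeSet) / ⌊(m : ℝ) ^ (1 / 8 : ℝ)⌋₊)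
        (univ : Finset ((⊤ : SimpleGraph (Fin m)).edgeSet))).image (fun M => fun e => decide (e ∉ M)))) := by
  intro c
  have hv2 : 1 ≤ (4 * (c + 4)).choose 2 := Nat.choose_pos (by omega)
  refine ⟨(4 * (c + 4)).choose 2 + 1, 16 * (c + 3), by omega, by omega, ?_⟩
  intro r s hr hs
  have hρ : 1 ≤ r - 1 := by omega
  filter_upwards [eventually_neg_numerics c (r - 1) s hs hρ, eventually_ge_atTop 17,
    eventually_ge_atTop (8 * (s - 1) ^ r)] with m hneg hm17 hm8
  intro φ D C A₀ hA₀w hA₀N hA₀P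
  -- the parameters `T = ⌊m^{1/16}⌋₊`, `D = ⌊m^{1/8}⌋₊`, `k = ⌈m^{1/4}⌉₊` and their sandwiches
  have hm1 : 1 ≤ m := by omega
  have hmT : m < (⌊(m : ℝ) ^ (1 / 16 : ℝ)⌋₊ + 1) ^ 16 :=
    lt_floor_rpow_add_one_pow m 16 (by norm_num)
  have hmD : m < (⌊(m : ℝ) ^ (1 / 8 : ℝ)⌋₊ + 1) ^ 8 := lt_floor_rpow_add_one_pow m 8 (by norm_num)
  have hkm : m ≤ ⌈(m : ℝ) ^ (1 / 4 : ℝ)⌉₊ ^ 4 := le_ceil_rpow_pow m 4 (by norm_num)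
  have hk1m : (⌈(m : ℝ) ^ (1 / 4 : ℝ)⌉₊ - 1) ^ 4 < m := ceil_rpow_sub_one_pow_lt hm1 4 (by norm_num)
  obtain ⟨hk2, hQ1, hpos⟩ := pos_numerics (c := c + 1) hm17 hm8 hkm hk1m
  set T := ⌊(m : ℝ) ^ (1 / 16 : ℝ)⌋₊ with hT
  set Dd := ⌊(m : ℝ) ^ (1 / 8 : ℝ)⌋₊ with hDd
  set k := ⌈(m : ℝ) ^ (1 / 4 : ℝ)⌉₊ with hk
  have hT1 : 1 ≤ T := Nat.pos_of_ne_zero fun h0 => by rw [h0] at hmT; norm_num at hmT; omega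
  have hD1 : 1 ≤ Dd := Nat.pos_of_ne_zero fun h0 => by rw [h0] at hmD; norm_num at hmD; omega
  -- two switchings of the short DNF `A₀`
  set ℓ := T * (Nat.log 2 T + 1) * (r - 1) with hℓ
  have hℓpos : 0 < ℓ := Nat.mul_pos (Nat.mul_pos hT1 (Nat.succ_pos _)) hρ
  obtain ⟨B, Cf, hBw, hCfw, hCfcard, hA₀B, hBCf⟩ :=
    monotoneSwitching_dnf A₀ (ℓ + 1) s (fun R hR => by rw [Nat.add_sub_cancel]; exact hA₀w R hR)
  rw [Nat.add_sub_cancel] at hCfcard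
  obtain ⟨A, Df, hAw, hDfw, hDfcard, hAB, hBA⟩ := monotoneSwitching_cnf B s r hBw
  refine ⟨A, B, hAw, hBw, hAB, ?_, ?_⟩
  · -- POSITIVE SIDE: the error is covered by the uncovered positives and the monomials of `Df`
    apply cast_le_eps_mul hm1
    set unc := (posGraphs m k).filter
      (fun x => φ.2 (fun j => decide (EvalDNF (D j) x)) = true ∧ ¬ EvalDNF A₀ x) with hunc
    set dfp := Df.biUnion fun R => (posGraphs m k).filter fun x => SatTerm R x with hdfp
    have hsub : (posGraphs m k).filter
        (fun x => φ.2 (fun j => decide (EvalDNF (D j) x)) = true ∧ ¬ EvalDNF A x) ⊆ unc ∪ dfp := by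
      intro x hx
      rw [Finset.mem_filter] at hx
      obtain ⟨hxP, hφx, hAx⟩ := hx
      by_cases hA₀x : EvalDNF A₀ x
      · rcases hBA x (hA₀B x hA₀x) with h | ⟨R, hR, hRx⟩
        · exact absurd h hAx
        · exact Finset.mem_union_right _
            (Finset.mem_biUnion.2 ⟨R, hR, Finset.mem_filter.2 ⟨hxP, hRx⟩⟩)
      · exact Finset.mem_union_left _ (Finset.mem_filter.2 ⟨hxP, hφx, hA₀x⟩)
    have hdf : #dfp * (16 * m ^ (c + 1)) ≤ #(posGraphs m k) := by
      have hstep := card_mul_le_of_subset_biUnion dfp Df _ (subset_refl _) fun R hR =>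
        card_filter_pos_mul_pow_le hk2 hQ1 (Nat.mul_div_le m k) R
          (show (4 * (c + 4)).choose 2 < #R by rw [hDfw R hR]; omega) (fun x => SatTerm R x)
          (fun x hx => hx)
      have h16 : 16 * m ^ (c + 1) * (s - 1) ^ r ≤ (m / k) ^ (4 * (c + 4)) :=
        le_trans (by
          calc 16 * m ^ (c + 1) * (s - 1) ^ r ≤ 8 * m * m ^ (c + 1) * (s - 1) ^ r := by
                have : 16 ≤ 8 * m := by omega
                gcongr
            _ = 8 * m ^ (c + 1 + 1) * (s - 1) ^ r := by ring) hpos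
      refine Nat.le_of_mul_le_mul_right ?_ (Nat.pow_pos (n := r) (show 0 < s - 1 by omega))
      calc #dfp * (16 * m ^ (c + 1)) * (s - 1) ^ r = #dfp * (16 * m ^ (c + 1) * (s - 1) ^ r) := by ring
        _ ≤ #dfp * (m / k) ^ (4 * (c + 4)) := Nat.mul_le_mul_left _ h16
        _ ≤ #Df * #(posGraphs m k) := hstep
        _ ≤ (s - 1) ^ r * #(posGraphs m k) := Nat.mul_le_mul_right _ hDfcard
        _ = #(posGraphs m k) * (s - 1) ^ r := Nat.mul_comm _ _
    calc #((posGraphs m k).filter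
            (fun x => φ.2 (fun j => decide (EvalDNF (D j) x)) = true ∧ ¬ EvalDNF A x)) *
            (8 * m ^ (c + 1))
        ≤ #(unc ∪ dfp) * (8 * m ^ (c + 1)) := Nat.mul_le_mul_right _ (Finset.card_le_card hsub)
      _ ≤ (#unc + #dfp) * (8 * m ^ (c + 1)) := Nat.mul_le_mul_right _ (Finset.card_union_le _ _)
      _ ≤ #(posGraphs m k) := by
          have h1 : #unc * (16 * m ^ (c + 1)) ≤ #(posGraphs m k) := hA₀P
          have e1 : #unc * (16 * m ^ (c + 1)) + #dfp * (16 * m ^ (c + 1)) =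
              2 * ((#unc + #dfp) * (8 * m ^ (c + 1))) := by ring
          omega
  · -- NEGATIVE SIDE: the error is covered by the exact `s`-clauses of `Cf`
    apply cast_le_eps_mul hm1
    have hsub : (((powersetCard (Fintype.card ((⊤ : SimpleGraph (Fin m)).edgeSet) / Dd)
        (univ : Finset ((⊤ : SimpleGraph (Fin m)).edgeSet))).image
          (fun M => fun e => decide (e ∉ M))).filter
          (fun x => EvalCNF B x ∧ φ.2 (fun j => decide (EvalCNF (C j) x)) = false)) ⊆
        Cf.biUnion fun S => (((powersetCard (Fintype.card ((⊤ : SimpleGraph (Fin m)).edgeSet) / Dd)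
          (univ : Finset ((⊤ : SimpleGraph (Fin m)).edgeSet))).image
            (fun M => fun e => decide (e ∉ M))).filter fun x => ¬ SatClause S x) := by
      intro x hx
      rw [Finset.mem_filter] at hx
      obtain ⟨hxN, hBx, hφx⟩ := hx
      have hnCf : ¬ EvalCNF Cf x := by
        intro hCfx
        have h2 := hA₀N x hxN (hBCf x hBx hCfx)
        rw [h2] at hφx
        exact Bool.noConfusion hφx
      obtain ⟨S, hS, hSx⟩ : ∃ S ∈ Cf, ¬ SatClause S x := by
        simpa [EvalCNF] using hnCf
      exact Finset.mem_biUnion.2 ⟨S, hS, Finset.mem_filter.2 ⟨hxN, hSx⟩⟩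
    have hstep := card_mul_le_of_subset_biUnion _ Cf _ hsub (W := Dd ^ s) fun S hS => by
      rw [← hCfw S hS]
      exact card_filter_neg_mul_pow_le hD1 (Nat.div_mul_le_self _ _)
        (fun M => fun e => decide (e ∉ M)) (fun M e => by simp) S _ (fun x hx => hx)
    refine Nat.le_of_mul_le_mul_right ?_ (Nat.pow_pos (n := s) hℓpos)
    calc _ = _ := Nat.mul_assoc _ _ _
      _ ≤ _ := Nat.mul_le_mul_left _ hneg
      _ ≤ _ := hstep
      _ ≤ ℓ ^ s * _ := Nat.mul_le_mul_right _ hCfcard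
      _ = _ := Nat.mul_comm _ _


open Classical in
/-- **Effectively narrow gates are sandwichable** (wire level). For every `c` there are `r₀, s₀`
such that for `r ≥ r₀`, `s ≥ s₀` and all large `m`: a MONOTONE gate `φ` fed with `(r-1)`-DNFs `D j`
below CNFs `C j` is sandwichable (conclusion of the stubs) as soon as every family of positives `x`
accepted through `D` WITHOUT any accepted sub-pattern of at most
`L = ⌊m^{1/16}⌋₊ (log₂ ⌊m^{1/16}⌋₊ + 1)` wires among the on-wires of `D(x)` has size
`≤ #P / (16 m^{c+1})` (stated on subfamilies, so no decidability instance is fixed). Narrow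
PERM/GRANK gates satisfy this with the empty exceptional family (`stub_narrowAlgebraic`); so do
GRANK gates of any width with threshold `θ ≤ L` (`grank_smallThreshold_sandwichable`). Proof: the
big DNF (`exists_bigDNF`) of the `L`-truncation `v ↦ [∃ S, #S ≤ L, S ⊆ on(v), φ(1_S) = 1]` of `φ`
is a short DNF as in `sandwichable_of_shortDNF`. [cite: Jukna2012, Lemma 9.15] -/
theorem sandwichable_of_shortPatterns : ∀ c : ℕ, ∃ r₀ s₀ : ℕ, 2 ≤ r₀ ∧ 2 ≤ s₀ ∧
    ∀ r s : ℕ, r₀ ≤ r → s₀ ≤ s →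
    ∀ᶠ m : ℕ in atTop, ∀ φ : GateFn, Monotone φ.2 →
      ∀ (D C : Fin φ.1 → Finset (Finset ((⊤ : SimpleGraph (Fin m)).edgeSet))),
        (∀ j, ∀ R ∈ D j, #R ≤ r - 1) → (∀ j x, EvalDNF (D j) x → EvalCNF (C j) x) →
        (∀ E ⊆ posGraphs m ⌈(m : ℝ) ^ (1 / 4 : ℝ)⌉₊,
          (∀ x ∈ E, φ.2 (fun j => decide (EvalDNF (D j) x)) = true ∧
            ∀ S : Finset (Fin φ.1), #S ≤ ⌊(m : ℝ) ^ (1 / 16 : ℝ)⌋₊ * (Nat.log 2 ⌊(m : ℝ) ^ (1 / 16 : ℝ)⌋₊ + 1) →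
              (∀ i ∈ S, EvalDNF (D i) x) → φ.2 (fun i => decide (i ∈ S)) = false) →
          #E * (16 * m ^ (c + 1)) ≤ #(posGraphs m ⌈(m : ℝ) ^ (1 / 4 : ℝ)⌉₊)) →
        ∃ dnf cnf : Finset (Finset ((⊤ : SimpleGraph (Fin m)).edgeSet)),
          (∀ R ∈ dnf, #R ≤ r - 1) ∧ (∀ S ∈ cnf, #S ≤ s - 1) ∧
          (∀ x, EvalDNF dnf x → EvalCNF cnf x) ∧
          (#((posGraphs m ⌈(m : ℝ) ^ (1 / 4 : ℝ)⌉₊).filter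
              (fun x => φ.2 (fun j => decide (EvalDNF (D j) x)) = true ∧ ¬ EvalDNF dnf x)) : ℝ)
            ≤ (1 / (8 * (m : ℝ) ^ (c + 1))) * #(posGraphs m ⌈(m : ℝ) ^ (1 / 4 : ℝ)⌉₊) ∧
          (#((((powersetCard (Fintype.card ((⊤ : SimpleGraph (Fin m)).edgeSet) / ⌊(m : ℝ) ^ (1 / 8 : ℝ)⌋₊)
          (univ : Finset ((⊤ : SimpleGraph (Fin m)).edgeSet))).image (fun M => fun e => decide (e ∉ M)))).filter
              (fun x => EvalCNF cnf x ∧ φ.2 (fun j => decide (EvalCNF (C j) x)) = false)) : ℝ)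
            ≤ (1 / (8 * (m : ℝ) ^ (c + 1))) *
              #(((powersetCard (Fintype.card ((⊤ : SimpleGraph (Fin m)).edgeSet) / ⌊(m : ℝ) ^ (1 / 8 : ℝ)⌋₊)
          (univ : Finset ((⊤ : SimpleGraph (Fin m)).edgeSet))).image (fun M => fun e => decide (e ∉ M)))) := by
  intro c
  obtain ⟨r₀, s₀, hr₀, hs₀, H⟩ := sandwichable_of_shortDNF c
  refine ⟨r₀, s₀, hr₀, hs₀, fun r s hr hs => ?_⟩
  filter_upwards [H r s hr hs] with m hm
  intro φ hmono D C hDw hDC hShort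
  set L := ⌊(m : ℝ) ^ (1 / 16 : ℝ)⌋₊ * (Nat.log 2 ⌊(m : ℝ) ^ (1 / 16 : ℝ)⌋₊ + 1) with hL
  -- the `L`-truncation of `φ`: accepted already by a short sub-pattern of the on-wires
  set f' : (Fin φ.1 → Bool) → Bool := fun v => decide (∃ S : Finset (Fin φ.1), #S ≤ L ∧
    (∀ i ∈ S, v i = true) ∧ φ.2 (fun i => decide (i ∈ S)) = true) with hf'
  have hf'le : ∀ v, f' v = true → φ.2 v = true := fun v hv => by
    obtain ⟨S, -, hSv, hS⟩ := of_decide_eq_true hv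
    refine eq_true_of_le_of_eq_true (hmono fun i => ?_) hS
    by_cases hi : i ∈ S
    · rw [decide_eq_true hi, hSv i hi]
    · rw [decide_eq_false hi]; exact Bool.false_le _
  have hf'mono : Monotone f' := fun v w hvw hv => by
    obtain ⟨S, hSL, hSv, hS⟩ := of_decide_eq_true hv
    exact decide_eq_true ⟨S, hSL, fun i hi => Bool.le_iff_imp.1 (hvw i) (hSv i hi), hS⟩
  have hcover : ∀ v, f' v = true → ∃ S : Finset (Fin φ.1), #S ≤ L ∧ (∀ i ∈ S, v i = true) ∧
      f' (fun i => decide (i ∈ S)) = true := fun v hv => by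
    obtain ⟨S, hSL, hSv, hS⟩ := of_decide_eq_true hv
    exact ⟨S, hSL, hSv, decide_eq_true ⟨S, hSL, fun i hi => decide_eq_true hi, hS⟩⟩
  obtain ⟨A₀, hA₀w, hA₀⟩ := exists_bigDNF f' hf'mono L (r - 1) hcover D hDw
  refine hm φ D C A₀ hA₀w (fun x _ hx => ?_) (hShort _ (filter_subset _ _) fun x hx => ?_)
  · -- on the negatives `A₀ ≤ f' ∘ D ≤ φ ∘ D ≤ φ ∘ C`
    refine eq_true_of_le_of_eq_true (hmono fun j => ?_) (hf'le _ ((hA₀ x).1 hx))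
    by_cases hDj : EvalDNF (D j) x
    · rw [decide_eq_true hDj, decide_eq_true (hDC j x hDj)]
    · rw [decide_eq_false hDj]; exact Bool.false_le _
  · -- an uncovered accepted positive has no short accepted sub-pattern
    rw [Finset.mem_filter] at hx
    refine ⟨hx.2.1, fun S hSL hSon => ?_⟩
    rw [← Bool.not_eq_true]
    intro hS
    refine hx.2.2 ((hA₀ x).2 (decide_eq_true ⟨S, hSL, fun i hi => decide_eq_true (hSon i hi), hS⟩))

open Classical in
/-- **Wide GRANK gates with a small rank threshold are sandwichable.** For every `c` there are
`r₀, s₀` such that for `r ≥ r₀`, `s ≥ s₀` and all large `m`: if `φ` accepts `v` iff the generic rank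
of `K₀ + ∑_{vᵢ = 1} Xᵢ Kᵢ` is at least `θ` (matrices of ANY dimension `d`, any field) and
`θ ≤ ⌊m^{1/16}⌋₊ (log₂ ⌊m^{1/16}⌋₊ + 1)`, then `φ` fed with `(r-1)`-DNFs below CNFs satisfies the
conclusion of `stub_algebraicSandwichable` — a non-vanishing `θ`-minor has a monomial with `≤ θ`
variables (`grank_local`), so every accepted pattern has an accepted sub-pattern of `≤ θ` wires and
`sandwichable_of_shortPatterns` applies with no exceptional positives. [folklore] -/
theorem grank_smallThreshold_sandwichable : ∀ c : ℕ, ∃ r₀ s₀ : ℕ, 2 ≤ r₀ ∧ 2 ≤ s₀ ∧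
    ∀ r s : ℕ, r₀ ≤ r → s₀ ≤ s →
    ∀ᶠ m : ℕ in atTop, ∀ (φ : GateFn) (F : Type) [Field F] (d θ : ℕ)
      (K₀ : Matrix (Fin d) (Fin d) F) (K : Fin φ.1 → Matrix (Fin d) (Fin d) F),
      (∀ v : Fin φ.1 → Bool, φ.2 v = true ↔ θ ≤ (symbolicMatrix K₀ K v).rank) →
      θ ≤ ⌊(m : ℝ) ^ (1 / 16 : ℝ)⌋₊ * (Nat.log 2 ⌊(m : ℝ) ^ (1 / 16 : ℝ)⌋₊ + 1) →
      ∀ (D C : Fin φ.1 → Finset (Finset ((⊤ : SimpleGraph (Fin m)).edgeSet))),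
        (∀ j, ∀ R ∈ D j, #R ≤ r - 1) → (∀ j x, EvalDNF (D j) x → EvalCNF (C j) x) →
        ∃ dnf cnf : Finset (Finset ((⊤ : SimpleGraph (Fin m)).edgeSet)),
          (∀ R ∈ dnf, #R ≤ r - 1) ∧ (∀ S ∈ cnf, #S ≤ s - 1) ∧
          (∀ x, EvalDNF dnf x → EvalCNF cnf x) ∧
          (#((posGraphs m ⌈(m : ℝ) ^ (1 / 4 : ℝ)⌉₊).filter
              (fun x => φ.2 (fun j => decide (EvalDNF (D j) x)) = true ∧ ¬ EvalDNF dnf x)) : ℝ)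
            ≤ (1 / (8 * (m : ℝ) ^ (c + 1))) * #(posGraphs m ⌈(m : ℝ) ^ (1 / 4 : ℝ)⌉₊) ∧
          (#((((powersetCard (Fintype.card ((⊤ : SimpleGraph (Fin m)).edgeSet) / ⌊(m : ℝ) ^ (1 / 8 : ℝ)⌋₊)
          (univ : Finset ((⊤ : SimpleGraph (Fin m)).edgeSet))).image (fun M => fun e => decide (e ∉ M)))).filter
              (fun x => EvalCNF cnf x ∧ φ.2 (fun j => decide (EvalCNF (C j) x)) = false)) : ℝ)
            ≤ (1 / (8 * (m : ℝ) ^ (c + 1))) *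
              #(((powersetCard (Fintype.card ((⊤ : SimpleGraph (Fin m)).edgeSet) / ⌊(m : ℝ) ^ (1 / 8 : ℝ)⌋₊)
          (univ : Finset ((⊤ : SimpleGraph (Fin m)).edgeSet))).image (fun M => fun e => decide (e ∉ M)))) := by
  intro c
  obtain ⟨r₀, s₀, hr₀, hs₀, H⟩ := sandwichable_of_shortPatterns c
  refine ⟨r₀, s₀, hr₀, hs₀, fun r s hr hs => ?_⟩
  filter_upwards [H r s hr hs] with m hm
  intro φ F _ d θ K₀ K hφ hθ D C hDw hDC
  have hG : IsGRankGate d φ := ⟨F, inferInstance, d, θ, le_rfl, K₀, K, hφ⟩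
  refine hm φ hG.monotone D C hDw hDC fun E hE hbad => ?_
  -- no exceptional positives: every accepted pattern has an accepted sub-pattern of `≤ θ` wires
  suffices hE0 : E = ∅ by rw [hE0, Finset.card_empty, Nat.zero_mul]; exact Nat.zero_le _
  refine Finset.eq_empty_of_forall_notMem fun x hx => ?_
  obtain ⟨hacc, hno⟩ := hbad x hx
  obtain ⟨t, htθ, -, hton, ht⟩ :=
    Summit.PneNP.PneNP.Theorems.Capture.Negative.grank_local K₀ K θ _ ((hφ _).1 hacc)
  have h1 := hno t (htθ.trans hθ) (fun i hi => of_decide_eq_true (hton i hi))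
  rw [(hφ _).2 ht] at h1
  exact Bool.noConfusion h1


open Classical in
/-- **Wide PERM gates generating a small group are sandwichable.** For every `c` there are
`r₀, s₀` such that for `r ≥ r₀`, `s ≥ s₀` and all large `m`: if `φ` accepts `v` iff
`τ ∈ ⟨σᵢ : vᵢ = 1⟩` (permutations of ANY number `d` of points) and the group generated by ALL the
`σᵢ` has fewer than `2^{L+1}` elements, `L = ⌊m^{1/16}⌋₊ (log₂ ⌊m^{1/16}⌋₊ + 1)` (e.g. monotone span
programs over `𝔽₂` of dimension `≤ L` on any number of points), then `φ` fed with `(r-1)`-DNFs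
below CNFs satisfies the conclusion of `stub_algebraicSandwichable`: a minimal accepting set of
generators is independent, so it has `≤ log₂ |⟨σ⟩| ≤ L` elements (`two_pow_card_le_card_closure`),
and `sandwichable_of_shortPatterns` applies with no exceptional positives. [folklore] -/
theorem perm_smallGroup_sandwichable : ∀ c : ℕ, ∃ r₀ s₀ : ℕ, 2 ≤ r₀ ∧ 2 ≤ s₀ ∧
    ∀ r s : ℕ, r₀ ≤ r → s₀ ≤ s →
    ∀ᶠ m : ℕ in atTop, ∀ (φ : GateFn) (d : ℕ) (σ : Fin φ.1 → Equiv.Perm (Fin d))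
      (τ : Equiv.Perm (Fin d)),
      (∀ v : Fin φ.1 → Bool, φ.2 v = true ↔ τ ∈ Subgroup.closure (σ '' {i | v i = true})) →
      Nat.card (Subgroup.closure (Set.range σ)) <
        2 ^ (⌊(m : ℝ) ^ (1 / 16 : ℝ)⌋₊ * (Nat.log 2 ⌊(m : ℝ) ^ (1 / 16 : ℝ)⌋₊ + 1) + 1) →
      ∀ (D C : Fin φ.1 → Finset (Finset ((⊤ : SimpleGraph (Fin m)).edgeSet))),
        (∀ j, ∀ R ∈ D j, #R ≤ r - 1) → (∀ j x, EvalDNF (D j) x → EvalCNF (C j) x) →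
        ∃ dnf cnf : Finset (Finset ((⊤ : SimpleGraph (Fin m)).edgeSet)),
          (∀ R ∈ dnf, #R ≤ r - 1) ∧ (∀ S ∈ cnf, #S ≤ s - 1) ∧
          (∀ x, EvalDNF dnf x → EvalCNF cnf x) ∧
          (#((posGraphs m ⌈(m : ℝ) ^ (1 / 4 : ℝ)⌉₊).filter
              (fun x => φ.2 (fun j => decide (EvalDNF (D j) x)) = true ∧ ¬ EvalDNF dnf x)) : ℝ)
            ≤ (1 / (8 * (m : ℝ) ^ (c + 1))) * #(posGraphs m ⌈(m : ℝ) ^ (1 / 4 : ℝ)⌉₊) ∧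
          (#((((powersetCard (Fintype.card ((⊤ : SimpleGraph (Fin m)).edgeSet) / ⌊(m : ℝ) ^ (1 / 8 : ℝ)⌋₊)
          (univ : Finset ((⊤ : SimpleGraph (Fin m)).edgeSet))).image (fun M => fun e => decide (e ∉ M)))).filter
              (fun x => EvalCNF cnf x ∧ φ.2 (fun j => decide (EvalCNF (C j) x)) = false)) : ℝ)
            ≤ (1 / (8 * (m : ℝ) ^ (c + 1))) *
              #(((powersetCard (Fintype.card ((⊤ : SimpleGraph (Fin m)).edgeSet) / ⌊(m : ℝ) ^ (1 / 8 : ℝ)⌋₊)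
          (univ : Finset ((⊤ : SimpleGraph (Fin m)).edgeSet))).image (fun M => fun e => decide (e ∉ M)))) := by
  intro c
  obtain ⟨r₀, s₀, hr₀, hs₀, H⟩ := sandwichable_of_shortPatterns c
  refine ⟨r₀, s₀, hr₀, hs₀, fun r s hr hs => ?_⟩
  filter_upwards [H r s hr hs] with m hm
  intro φ d σ τ hφ hsmall D C hDw hDC
  set L := ⌊(m : ℝ) ^ (1 / 16 : ℝ)⌋₊ * (Nat.log 2 ⌊(m : ℝ) ^ (1 / 16 : ℝ)⌋₊ + 1) with hL
  have hP : IsPermGate d φ := ⟨d, le_rfl, σ, τ, hφ⟩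
  refine hm φ hP.monotone D C hDw hDC fun E hE hbad => ?_
  -- no exceptional positives: a minimal accepting generator set has `≤ L` elements
  suffices hE0 : E = ∅ by rw [hE0, Finset.card_empty, Nat.zero_mul]; exact Nat.zero_le _
  refine Finset.eq_empty_of_forall_notMem fun x hx => ?_
  obtain ⟨hacc, hno⟩ := hbad x hx
  set v : Fin φ.1 → Bool := fun j => decide (EvalDNF (D j) x) with hv
  -- accepted sub-selections of the on-wires, and one of minimal cardinality
  set S : Finset (Finset (Fin φ.1)) := (Finset.univ.filter fun i => v i = true).powerset.filter
    fun t => τ ∈ Subgroup.closure (σ '' (↑t : Set (Fin φ.1))) with hS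
  have hSne : S.Nonempty := by
    refine ⟨Finset.univ.filter fun i => v i = true, ?_⟩
    simp only [hS, Finset.mem_filter, Finset.mem_powerset, Finset.Subset.refl, true_and]
    have := (hφ v).1 hacc
    convert this using 3
    ext i; simp
  obtain ⟨t, htS, htmin⟩ := S.exists_min_image Finset.card hSne
  simp only [hS, Finset.mem_filter, Finset.mem_powerset] at htS
  obtain ⟨htsub, ht⟩ := htS
  have hind : ∀ i ∈ t, σ i ∉ Subgroup.closure (σ '' ↑(t.erase i)) := by
    intro i hi hmem
    have hmem' : τ ∈ Subgroup.closure (σ '' ↑(t.erase i)) := by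
      refine (Subgroup.closure_le _).2 ?_ ht
      rintro _ ⟨j, hj, rfl⟩
      by_cases hji : j = i
      · subst hji; exact hmem
      · exact Subgroup.subset_closure ⟨j, by simp [hji, hj], rfl⟩
    have hmemS : t.erase i ∈ S := by
      simp only [hS, Finset.mem_filter, Finset.mem_powerset]
      exact ⟨(Finset.erase_subset i t).trans htsub, hmem'⟩
    have := htmin _ hmemS
    rw [Finset.card_erase_of_mem hi] at this
    have hpos : 0 < t.card := Finset.card_pos.2 ⟨i, hi⟩
    omega
  have hcard : 2 ^ t.card < 2 ^ (L + 1) :=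
    calc 2 ^ t.card ≤ Nat.card (Subgroup.closure (σ '' (↑t : Set (Fin φ.1)))) :=
          Summit.PneNP.PneNP.Theorems.Capture.Negative.two_pow_card_le_card_closure σ t hind
      _ ≤ Nat.card (Subgroup.closure (Set.range σ)) :=
          Subgroup.card_le_of_le (Subgroup.closure_mono (Set.image_subset_range _ _))
      _ < 2 ^ (L + 1) := hsmall
  have htL : #t ≤ L := by
    have := (Nat.pow_lt_pow_iff_right (by norm_num : 1 < 2)).1 hcard
    omega
  have h1 := hno t htL fun i hi => by simpa [hv] using htsub hi
  have h2 : φ.2 (fun i => decide (i ∈ t)) = true := by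
    rw [hφ]
    convert ht using 3
    ext i; simp
  rw [h2] at h1
  exact Bool.noConfusion h1

end Summit.PneNP.PneNP.Theorems.CliqueExtLowerBound.WidthThreshold.SandwichEffectiveWidth
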